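import Mathlib
import HarnessLib
import Summits.HubbardSuperconductivity.HubbardSuperconductivity.Theorems.KLProgrammeKLRegimeEngineTowerLevAssemblyKlEngFinalRowsClosedG
import Summits.HubbardSuperconductivity.HubbardSuperconductivity.Theorems.KLProgrammeKLRegimeEngineTowerLevAssemblyKlEngNum
import Summits.HubbardSuperconductivity.HubbardSuperconductivity.Theorems.KLProgrammeKLRegimeEngineTowerLevNumericsPackageRB
import Summits.HubbardSuperconductivity.HubbardSuperconductivity.Theorems.KLProgrammeKLRegimeEngineTowerLevNumericsPackageZ
import Summits.HubbardSuperconductivity.HubbardSuperconductivity.Theorems.KLProgrammeKLRegimeEngineTowerLevLawOfRowsF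

/-!
# Route `KLProgramme` — crux K3 ENGINE (stmt-HubbardSuperconductivity-20437 `KLRegimeEngineV17F2`), stub (b) v2, THE LEVELS PACKAGE (ℓ), numerics side
# «(ℓ)-NUMERICS-FINAL-RC» (cell gate-hubbard-kl, seat p4 g22): THE LEVELS CLAUSE ON THE FLOW FRAME WITH THE MAIN TOWER's AND BLOCK 0's NUMERICS DISCHARGED
# ON SHAPES — the closed-numR twin of `kernelNormsLevels_all_klEng_numR` (p700315) on the CLOSED assembly (base datum and `Z^{K_n}_{Λ_d}` from block 0)

Keyed on `kernelNormsLevels_all_klEng_final_rows_closedG (c″)` (…FinalRowsClosedG = p3 g22's p699409 with the domination rows guarded by `d ≤ n`) and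
composed with this lineage's `levNumerics_packageRB` (main tower, any `Bf` above its threshold), `levNumerics_packageZ` (block 0), `exists_blockLen_klEng`,
`exists_degreeCap_all`, `beta_le_of_klEngM₃_le` and the tree's `klTowerMuLevF_one_le_of_baseRows` (…TowerLevLawOfRowsF, at `d := 1`).
**`kernelNormsLevels_all_klEng_numRC (c″)`** = p699409 with — MAIN TOWER (exactly as numR): the blocking row GONE (`∃ d₀ ≥ 2, ∀ d ≥ d₀`); `∀ D` and the
degree caps GONE; `∀ B`, `B ≥ B₀`, both coupling doors and the CE rows GONE — replaced by `∃ ab qb Bf uf CEf`, the doors `U ≤ uf/(2·Bf·P.Klam+1)`,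
`cc ≤ uf·log 4/(2·Bf·P.Klam+1)`, ONE threshold `CEf ≤ Qe.CE`, the import shapes `ι₁ ≤ i₁(M/β)`, `ι₂ ≤ i₂(M/β)³`, `X ≤ x₆(M/β)⁵`; NEW w.r.t. numR: the main
tower's base AMPLITUDES are OUTPUTS of the numerics — `Ab = ab·(β/M)`, `Qb = qb·(M/β)²` with `ab = aT₁`, `qb = qT₁` read off block 0's data (the located
«(ℓ)-BLOCK0-DOMINATION» fixed point: every block-0 read-out term carries `(β/M)/Bf²`, so `Atot₁ ≤ aT₁(β/M)/Bf² = Ab/Bf²`, `Qtot₁ ≤ qT₁(M/β)² = Qb`).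
BLOCK 0: the level-0 datum rows on the SHAPES `Ab₀ = ab₀·(β/M)/Bf²`, `Qb₀ = qb₀·(M/β)²` (= `exists_levelZeroBaseRows_klEng` by name: `A₁ε_x/Klam²/B²`,
`P₁/ε_x²`), block 0's imports `0 ≤ ι₁₀ ≤ i₁₀(M/β)`, `0 ≤ ι₂₀ ≤ i₂₀(M/β)³` read PRIMED (`ι₁₀′ = ι₁₀/Bf`, `ι₂₀′ = ι₂₀/Bf`) in the two import rows at `λ₁`, the
Chernoff profile PINNED `A′₀ = 27⁵W₀Ab₀`, `Q′₀ = Z₀Qb₀ + 1`, `ι₃₀ = A′₀Q′₀³` (equational); GONE: `0 ≤ Ab₀`, `0 ≤ Qb₀`, `0 ≤ A′₀`, `0 < Q′₀` (derived), the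
Chernoff rows `hprof₀`, `hprof3₀` (DERIVED from the datum rows, `klTowerMuLevF_one_le_of_baseRows`), the kit cap at `sectorCount 0`, the five smallness rows,
block 0's read-out constants `Aro₀ Qro₀ Qtot₀ Atot₀ / Aro₁ Qro₁ Qtot₁ Atot₁` with their CE rows, DOMINATION and kit GUARD (all discharged by
`levNumerics_packageZ`; the read-out constants are instantiated by `rfl`).  The level `j = 0` group (weighted grid step at `(Λ_0, F_0)`) is verbatim at `B := Bf`.
So the levels clause is typed MODULO: `Z ≠ 0` at `Λ_1`; the level-0 datum rows and block-0 imports on shapes; the main imports/cells; the level-0 grid rows —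
and NO numerics.  Composition of landed theorems + the KL-regime arithmetic `λ_j = Bf·Klam(|U|+U²j) ≤ uf`; nothing about the model is asserted beyond them;
nothing asserts (ℓ), any stub, K3 or superconductivity.
References: BGM 2006 §2.8 (2.76)–(2.84), (2.93)–(2.98), Lemma 2.5, §3 (3.2)–(3.8) [cite: BenfattoGiulianiMastropietro2006].
-/

noncomputable section

namespace Summit.HubbardSuperconductivity.HubbardSuperconductivity.Theorems.EngineV8

set_option linter.dupNamespace false -- summit = problem name (single-conjunct summit), D-0017

open Classical
open Real Finset Literature.MathematicalPhysics.QuantumLattice Literature.Probability.LatticeModels GrassmannAlgebra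
open Literature.Probability.LatticeModels.BattleFederbush
open Literature.MathematicalPhysics.QuantumLattice.FermiRG
open Summit.HubbardSuperconductivity.HubbardSuperconductivity.Theorems.KLProgrammeLegKernels
open Summit.HubbardSuperconductivity.HubbardSuperconductivity.Theorems.KLRegimeSplit
open Summit.HubbardSuperconductivity.HubbardSuperconductivity.Theorems.KLRegimeWick
open Summit.HubbardSuperconductivity.HubbardSuperconductivity.Theorems.TorusFourierL2
open Summit.HubbardSuperconductivity.HubbardSuperconductivity.Theorems.DispersionFlow

variable {L M : ℕ} [NeZero L] [NeZero M]

set_option maxHeartbeats 1600000 in -- one ~190-binder composition + two packages' closed forms (measured well below; cap with margin)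
/-- **THE LEVELS CLAUSE ON THE FLOW FRAME, MAIN-TOWER AND BLOCK-0 NUMERICS DISCHARGED ON SHAPES** (closed assembly; see the module docstring for exactly which
binders of `kernelNormsLevels_all_klEng_final_rows_closedG` are gone and what replaces them).
[cite: BenfattoGiulianiMastropietro2006, §2.8 (2.76)-(2.84), (2.93)-(2.98), Lemma 2.5, §3 (3.2)-(3.8)] -/
theorem kernelNormsLevels_all_klEng_numRC (c'' : ℝ) (hc'' : 0 < c'') :
    ∃ C₁ C₂ C₁' C₂' Cinc Dinc : ℝ, 0 < C₁ ∧ 0 < C₂ ∧ 0 < C₁' ∧ 0 < C₂' ∧ 0 < Cinc ∧ 1 ≤ Dinc ∧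
    ∀ R : RenConsts, R.WF2 → ∃ c₃' : ℝ, 0 < c₃' ∧ ∃ U₀' : ℝ, 0 < U₀' ∧
      ∃ Cκ CJ : ℝ, 0 < Cκ ∧ 0 < CJ ∧ ∃ d₀ : ℕ, 2 ≤ d₀ ∧ ∀ d : ℕ, d₀ ≤ d → ∃ Cb : ℝ, 0 < Cb ∧
      -- block 0's own constants (p3 g22's `kernelNormsLevels_blockZeroF_klEng d c''`): increment constants, thresholds, link triple — all indexed by `d`
      ∃ Cinc₀ Dinc₀ Cinc₁ Dinc₁ c₃'' U₀'' : ℝ, 0 < Cinc₀ ∧ 1 ≤ Dinc₀ ∧ 1 ≤ Cinc₁ ∧ 1 ≤ Dinc₁ ∧ 0 < c₃'' ∧ 0 < U₀'' ∧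
      ∃ Cκ₀ Cb₀ CJ₀ : ℝ, 0 < Cκ₀ ∧ 0 < Cb₀ ∧ 0 < CJ₀ ∧
      ∀ (G : GeoConsts) (P : SplitConsts) (Qh : EngConsts) (c : ℝ), P.WF → 0 < c → c ≤ klEngC₃6 P R → c ≤ c₃' → c ≤ c₃'' →
      -- the SHAPE constants of the data suppliers: the main tower's imports `i₁ i₂ x₆`, block 0's level-0 datum `ab₀ qb₀` and imports `i₁₀ i₂₀`
      ∀ (i₁ i₂ x₆ ab₀ qb₀ i₁₀ i₂₀ : ℝ), 0 ≤ i₁ → 0 ≤ i₂ → 0 ≤ x₆ → 0 < ab₀ → 0 < qb₀ → 0 ≤ i₁₀ → 0 ≤ i₂₀ →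
      -- the numerics' OUTPUTS: the main tower's base amplitudes `ab qb`, the coupling rescaling `Bf`, the door `uf`, the public threshold `CEf`
      ∃ ab qb Bf uf CEf : ℝ, 0 < ab ∧ 0 < qb ∧ 1 ≤ Bf ∧ 0 < uf ∧ 0 ≤ CEf ∧
      ∀ μ ∈ klWindowC, ∀ U : ℝ, 0 < U → U ≤ klEngU₀9 P R c → U ≤ U₀' → U ≤ U₀'' → c'' * U ≤ 1 → U ≤ uf / (2 * Bf * P.Klam + 1) →
      ∀ β : ℝ, klBetaMin ≤ β → β ≤ Real.exp (c / U ^ 2) →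
      ∀ (L M : ℕ) [NeZero L] [NeZero M], klEngL₃ β U ≤ L → klEngM₃ β U L ≤ M →
      ∀ n : ℕ, 1 ≤ n → n ≤ nScales β + 1 → IsKLRegime U c (-(n : ℤ)) →
        HistP klPredsV17F2 L M G P Qh R β U μ 0 n → FrameOK R U (nScales β) μ (klFlowFrameU L M β U μ n) →
        (∀ m, 1 ≤ m → m < n → FlowPieceOscAt L M c'' β U μ m) →
      2 ≤ d →
      ∀ (cc : ℝ) (n' : ℕ), IsKLRegime U cc (-(n' : ℤ)) → n ≤ n' → cc ≤ uf * Real.log 4 / (2 * Bf * P.Klam + 1) →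
      -- the main tower's base AMPLITUDES (outputs, pinned: `Ab = ab·(β/M)`, `Qb = qb·(M/β)²`), E1's imports ON THEIR SHAPES, the primed versions at `B := Bf`
      ∀ (Ab Qb ι₂ X : ℝ), Ab = ab * (β / M) → Qb = qb * ((M : ℝ) / β) ^ 2 → 0 ≤ ι₂ → ι₂ ≤ i₂ * ((M : ℝ) / β) ^ 3 → 0 ≤ X → X ≤ x₆ * ((M : ℝ) / β) ^ 5 →
      ∀ (Ab' ι₂' X' : ℝ), Ab' = Ab / Bf ^ 2 → ι₂' = ι₂ / Bf → X' = X / Bf ^ 2 →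
      -- the floor LINK data DISCHARGED on the flow frame (`linkDataPartialF_klEng'`): the four k-free constants pinned, the degree cap kept
      ∀ (κb αb crb ccb : ℝ), κb = Real.sqrt (2 * Cκ * klE0) → αb = Cb * ((M : ℝ) / β) * (4 : ℝ) ^ d / klE0 →
        crb = 81 * CJ * M / β → ccb = 162 * CJ * M / β →
      -- the law's six names PINNED by the link (equational binders), and the import `ι₁`
      ∀ (W Z σ Φ ψ τ ι₁ : ℝ), W = 64 * (27 : ℝ) ^ 4 * exp 2 * crb / ccb → Z = exp 4 * ccb ^ 2 * imagTimeWeight β M ^ 2 / 8 →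
        σ = κb ^ 2 / (exp 4 * ccb ^ 2) → Φ = 9 * αb * ccb / ((27 : ℝ) ^ 5 * exp 1 * κb ^ 2 * crb) → ψ = exp 4 * ccb ^ 2 / κb ^ 2 →
        τ = exp 2 * κb ^ 2 / ccb ^ 2 → 0 ≤ ι₁ → ι₁ ≤ i₁ * ((M : ℝ) / β) →
      ∀ (ρk Q' Q κA Yb Y A A' ι₃ : ℝ), ρk = max 4 (2 * τ * ψ) → Q' = Z * Qb + 1 → Q = ρk * Q' →
        κA = W * ((27 : ℝ) ^ 5 * (C₁ / C₂) * (8 : ℝ) ^ (d - 1)) →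
        Yb = ι₂ / (2 * Q') + W * Z ^ 3 * X / (4 * Q' ^ 2) + (W * (27 : ℝ) ^ 5 * Ab + κA * Ab) * Q' / 2 →
        Y = ι₂' / (2 * Q') + W * Z ^ 3 * X' / (4 * Q' ^ 2) + (W * (27 : ℝ) ^ 5 * Ab' + κA * Ab') * Q' / 2 →
        A = 2 * Y * (1 - ((2 : ℝ) ^ d)⁻¹) / (κA * Q') →
        A' = (W * (27 : ℝ) ^ 5 * Ab' + κA * Ab') + 2 * Y / Q' → ι₃ = W * Z ^ 3 * X' + A' * Q' ^ 3 →
      -- E1's imports and six-leg cells, block by block, each at the block's own base level `λ_{dk} = Bf·ε_{dk}` (monotone in the level)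
      (∀ k, 1 ≤ k → d * k ≤ n → W * Z ^ 1 * klTowerMuLevF L M β U μ (klFlowFrameU L M β U μ n) d k 1 ≤ ι₁ * (Bf * epsCoupling P U (d * k))) →
      (∀ k, 1 ≤ k → d * k ≤ n → W * Z ^ 2 * klTowerMuLevF L M β U μ (klFlowFrameU L M β U μ n) d k 2 ≤ ι₂' * (Bf * epsCoupling P U (d * k))) →
      (∀ k, 2 ≤ k → d * k ≤ n → klTowerMuLevAtF L M β U μ (klFlowFrameU L M β U μ n) d 0 k 3 ≤ X' * (Bf * epsCoupling P U (d * k)) ^ 2) →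
      -- the read-out constants (equational binders; `Atot` level by level through `λ_j = Bf·ε_j`), the public constant's threshold at every level `d ≤ j ≤ n`,
      -- the degree cap, the six-leg cells at every level `d ≤ j ≤ n`
      ∀ (Aro Qro Qtot : ℝ) (Atot : ℕ → ℝ), Aro = (27 : ℝ) ^ 5 * (C₁' / C₂') * (Ab' + (8 : ℝ) ^ (d - 1) * (A / (1 - ((2 : ℝ) ^ d)⁻¹))) →
        Qro = C₂' ^ 2 * max Qb (((2 : ℝ) ^ (d - 1))⁻¹ * max Q Qb) → Qtot = Dinc * max 1 (max Qro (max (4 * Q') (2 * τ * ψ * Q'))) →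
        (∀ j : ℕ, Atot j = Aro + Cinc * (A' * (4 * σ * (Bf * epsCoupling P U j) * Q' / (1 - 4 * σ * (Bf * epsCoupling P U j) * Q')) +
          exp 1 * (τ * (ι₁ * (Bf * epsCoupling P U j) + ι₂' / (2 * Q') + ι₃ / (4 * Q' ^ 2) + A' * Q' / 4)) *
            (Φ * (τ * (ι₁ * (Bf * epsCoupling P U j) + ι₂' / (2 * Q') + ι₃ / (4 * Q' ^ 2) + A' * Q' / 4)) /
              (1 - Φ * (τ * (ι₁ * (Bf * epsCoupling P U j) + ι₂' / (2 * Q') + ι₃ / (4 * Q' ^ 2) + A' * Q' / 4)))) / (2 * τ * Q'))) →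
      ∀ Qe : EngConsts, CEf ≤ Qe.CE →
      (∀ j : ℕ, 1 ≤ j → j ≤ n → ∀ Ωe : Fin (2 * 3) → Option (SectorLeg (sectorCount j)), levelCount Ωe = 1 →
        klAnisoLegKernelNormAt L M β U μ (klFlowFrameU L M β U μ n) klE0 j (2 * 3) Ωe ≤ Qe.CE ^ 3 * (epsCoupling P U j) ^ 2 * (2 : ℝ) ^ ((4 : ℤ) * j)) →
      -- BLOCK 0 (levels `1 ≤ j < d` and the main tower's base datum): `Z` at `Λ_1`; the level-0 datum rows ON THE SHAPES `Ab₀ = ab₀·(β/M)/Bf²`,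
      -- `Qb₀ = qb₀·(M/β)²`; block 0's imports ON THEIR SHAPES and primed; block 0's KlEng pins; the Chernoff profile PINNED on the datum; the two import rows at `λ_1`
      hubbardEffPartitionFnCT L M β U μ 0 (klFlowFrameU L M β U μ n) (klScale klE0 1) ≠ 0 →
      ∀ (Ab₀ Qb₀ ι₁₀ ι₂₀ : ℝ), Ab₀ = ab₀ * (β / M) / Bf ^ 2 → Qb₀ = qb₀ * ((M : ℝ) / β) ^ 2 →
        0 ≤ ι₁₀ → ι₁₀ ≤ i₁₀ * ((M : ℝ) / β) → 0 ≤ ι₂₀ → ι₂₀ ≤ i₂₀ * ((M : ℝ) / β) ^ 3 →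
      ∀ (ι₁₀' ι₂₀' : ℝ), ι₁₀' = ι₁₀ / Bf → ι₂₀' = ι₂₀ / Bf →
      ∀ Nb₀ : Fin 5 → ℕ → ℝ, (∀ t p, 0 ≤ Nb₀ t p) →
        (∀ (t : Fin 5) (p : ℕ) (Ωe' : Fin (2 * p) → Option (SectorLeg (sectorCount 0))), levelCount Ωe' = (t : ℕ) + 1 →
          klLevNormOf L M β μ (klFlowFrameU L M β U μ n) 0 (2 * p) (klTowerInput L M β U μ (klFlowFrameU L M β U μ n) 1 1) Ωe' ≤ Nb₀ t p) →
        (∀ (t : Fin 5) (p : ℕ), 3 ≤ p → Nb₀ t p / klLevUnitF β M t p 0 ≤ Ab₀ * (Bf * epsCoupling P U 1) ^ (p - 1) * Qb₀ ^ p) →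
      ∀ (κb₀ αb₀ crb₀ ccb₀ : ℝ), κb₀ = Real.sqrt (2 * Cκ₀ * klE0) → αb₀ = Cb₀ * ((M : ℝ) / β) * (4 : ℝ) ^ d / klE0 →
        crb₀ = 81 * CJ₀ * M / β → ccb₀ = 162 * CJ₀ * M / β →
      ∀ (W₀ Z₀ σ₀ Φ₀ ψ₀ τ₀ : ℝ), W₀ = 64 * (27 : ℝ) ^ 4 * exp 2 * crb₀ / ccb₀ → Z₀ = exp 4 * ccb₀ ^ 2 * imagTimeWeight β M ^ 2 / 8 →
        σ₀ = κb₀ ^ 2 / (exp 4 * ccb₀ ^ 2) → Φ₀ = 9 * αb₀ * ccb₀ / ((27 : ℝ) ^ 5 * exp 1 * κb₀ ^ 2 * crb₀) → ψ₀ = exp 4 * ccb₀ ^ 2 / κb₀ ^ 2 →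
        τ₀ = exp 2 * κb₀ ^ 2 / ccb₀ ^ 2 →
      ∀ (A'₀ Q'₀ ι₃₀ : ℝ), A'₀ = (27 : ℝ) ^ 5 * W₀ * Ab₀ → Q'₀ = Z₀ * Qb₀ + 1 → ι₃₀ = A'₀ * Q'₀ ^ 3 →
      W₀ * Z₀ ^ 1 * klTowerMuLevF L M β U μ (klFlowFrameU L M β U μ n) 1 1 1 ≤ ι₁₀' * (Bf * epsCoupling P U 1) →
      W₀ * Z₀ ^ 2 * klTowerMuLevF L M β U μ (klFlowFrameU L M β U μ n) 1 1 2 ≤ ι₂₀' * (Bf * epsCoupling P U 1) →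
      -- THE LEVEL `j = 0`: p3's weighted grid step at `(Λ_0, F_0)` (RO-3's closer `kernelNormsLevels_uvF_of_wgridStep` at `j = 0`)
      ∀ (jw0 : ℕ) (κ0 αw0 ρ0 crw0 ccw0 : ℝ), 0 < κ0 →
        IsGramBoundedR ((hubbardGridSub L M β (2 * (2 * M))).transpose * hubbardCovAboveCT L M β μ 0 (klFlowFrameU L M β U μ n) (klScale klE0 0) *
          hubbardGridSub L M β (2 * (2 * M))) κ0 →
        0 < αw0 →
        (∀ X, ∑ Y, ‖((hubbardGridSub L M β (2 * (2 * M))).transpose * hubbardCovAboveCT L M β μ 0 (klFlowFrameU L M β U μ n) (klScale klE0 0) *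
          hubbardGridSub L M β (2 * (2 * M))) X Y‖ * gridLabelWt L (2 * (2 * M)) β {gridLegPos X, gridLegPos Y} ≤ αw0) →
        (∀ Y, ∑ X, ‖((hubbardGridSub L M β (2 * (2 * M))).transpose * hubbardCovAboveCT L M β μ 0 (klFlowFrameU L M β U μ n) (klScale klE0 0) *
          hubbardGridSub L M β (2 * (2 * M))) X Y‖ * gridLabelWt L (2 * (2 * M)) β {gridLegPos X, gridLegPos Y} ≤ αw0) →
        0 < ρ0 →
        Real.exp 1 * αw0 * normV (GridLeg (GridPoint L (2 * (2 * M)))) κ0 ρ0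
          (fun m' : ℕ => if m' = 1 then |β| / (2 * (2 * M) : ℕ) * ∑ z : TorusSite 2 L, ‖framePosKernel L (klFlowFrameU L M β U μ n) z‖ * (1 + torusSiteDist z 0)
            else if m' = 2 then |U| * |β| / (2 * (2 * M) : ℕ) else 0) / κ0 ^ 2 < 1 →
        0 < crw0 → 0 < ccw0 →
        (∀ X'' : SpaceTimeIdx L M × SectorLeg (sectorCount 0), ∑ X' : GridLeg (GridPoint L (2 * (2 * M))),
          ‖(sectorAnalysisMatrix L M β (klAnisoFamily L M β μ (klFlowFrameU L M β U μ n) klE0 0) * hubbardGridSub L M β (2 * (2 * M))) X'' X'‖ *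
            gridLabelWt L (2 * (2 * M)) β {latticeLegPos (2 * (2 * M)) X'', gridLegPos X'} ≤ crw0) →
        (∀ X' : GridLeg (GridPoint L (2 * (2 * M))), ∑ X'' : SpaceTimeIdx L M × SectorLeg (sectorCount 0),
          ‖(sectorAnalysisMatrix L M β (klAnisoFamily L M β μ (klFlowFrameU L M β U μ n) klE0 0) * hubbardGridSub L M β (2 * (2 * M))) X'' X'‖ *
            gridLabelWt L (2 * (2 * M)) β {latticeLegPos (2 * (2 * M)) X'', gridLegPos X'} ≤ ccw0) →
      ∀ (nV0 cF0 cg0 Ag0 Pg0 Auv0 Quv0 : ℝ),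
        nV0 = normV (GridLeg (GridPoint L (2 * (2 * M)))) κ0 ρ0
          (fun m' : ℕ => if m' = 1 then |β| / (2 * (2 * M) : ℕ) * ∑ z : TorusSite 2 L, ‖framePosKernel L (klFlowFrameU L M β U μ n) z‖ * (1 + torusSiteDist z 0)
            else if m' = 2 then |U| * |β| / (2 * (2 * M) : ℕ) else 0) →
        cF0 = (Real.exp 2 * (κ0 + ρ0)) ^ (2 * 2) * (|β| / (2 * (2 * M) : ℕ)) → cg0 = Real.exp 1 * αw0 * cF0 / κ0 ^ 2 →
        Ag0 = crw0 * Real.exp 1 * cF0 / (ccw0 * cg0 ^ 2) → Pg0 = ccw0 ^ 2 * cg0 / (ρ0 ^ 2 * (1 - Real.exp 1 * αw0 * nV0 / κ0 ^ 2)) →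
        Auv0 = (2 : ℝ) ^ (7 * 0) * Ag0 / P.Klam ^ 2 / Bf ^ 2 → Quv0 = Pg0 / (8 : ℝ) ^ 0 →
        Quv0 * imagTimeWeight β M ^ 2 * Bf * max 1 (Auv0 / imagTimeWeight β M) ≤ Qe.CE →
      ∀ j : ℕ, j ≤ n → KernelNormsLevels L M P Qe β U μ (klFlowFrameU L M β U μ n) j := by
  obtain ⟨C₁, C₂, C₁', C₂', Cinc, Dinc, hC₁, hC₂, hC₁', hC₂', hCinc, hDinc, h⟩ := kernelNormsLevels_all_klEng_final_rows_closedG c'' hc''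
  refine ⟨C₁, C₂, C₁', C₂', Cinc, Dinc, hC₁, hC₂, hC₁', hC₂', hCinc, hDinc, fun R hR2 => ?_⟩
  obtain ⟨c₃, hc₃, U₀, hU₀, Cκ, CJ, hCκ, hCJ, hd⟩ := h R hR2
  obtain ⟨d₀, hd₀2, hblk⟩ := exists_blockLen_klEng C₂ CJ
  refine ⟨c₃, hc₃, U₀, hU₀, Cκ, CJ, hCκ, hCJ, d₀, hd₀2, fun d hd₀d => ?_⟩
  obtain ⟨Cb, hCb, Cinc₀, Dinc₀, Cinc₁, Dinc₁, c₃'', U₀'', hCinc₀, hDinc₀, hCinc₁, hDinc₁, hc₃'', hU₀'', Cκ₀, Cb₀, CJ₀, hCκ₀, hCb₀, hCJ₀, h'⟩ := hd d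
  refine ⟨Cb, hCb, Cinc₀, Dinc₀, Cinc₁, Dinc₁, c₃'', U₀'', hCinc₀, hDinc₀, hCinc₁, hDinc₁, hc₃'', hU₀'', Cκ₀, Cb₀, CJ₀, hCκ₀, hCb₀, hCJ₀, ?_⟩
  intro G P Qh c hP hc hc6 hc₃' hc₃'' i₁ i₂ x₆ ab₀ qb₀ i₁₀ i₂₀ hi₁ hi₂ hx₆ hab₀ hqb₀ hi₁₀ hi₂₀
  have hd2 : 2 ≤ d := le_trans hd₀2 hd₀d
  have hK1 : 1 ≤ P.Klam := hP.1
  -- block 0's r-free closed forms (…NumericsPackageZ), ending in the main tower's amplitudes `ab := aT₁`, `qb := qT₁`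
  obtain ⟨zW, hzW⟩ : ∃ x : ℝ, x = 32 * (27 : ℝ) ^ 4 * exp 2 := ⟨_, rfl⟩
  obtain ⟨zZ, hzZ⟩ : ∃ x : ℝ, x = exp 4 * (81 * CJ₀) ^ 2 / 8 := ⟨_, rfl⟩
  obtain ⟨zs, hzs⟩ : ∃ x : ℝ, x = 2 * Cκ₀ * klE0 / (exp 4 * 162 ^ 2 * CJ₀ ^ 2) := ⟨_, rfl⟩
  obtain ⟨zt, hzt⟩ : ∃ x : ℝ, x = exp 2 * (2 * Cκ₀ * klE0) / (162 ^ 2 * CJ₀ ^ 2) := ⟨_, rfl⟩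
  obtain ⟨zp, hzp⟩ : ∃ x : ℝ, x = exp 4 * 162 ^ 2 * CJ₀ ^ 2 / (2 * Cκ₀ * klE0) := ⟨_, rfl⟩
  obtain ⟨zφ, hzφ⟩ : ∃ x : ℝ, x = 9 * Cb₀ * (4 : ℝ) ^ d / ((27 : ℝ) ^ 5 * exp 1 * Cκ₀ * klE0 ^ 2) := ⟨_, rfl⟩
  obtain ⟨zQL, hzQL⟩ : ∃ x : ℝ, x = zZ * qb₀ := ⟨_, rfl⟩
  obtain ⟨zQH, hzQH⟩ : ∃ x : ℝ, x = zZ * qb₀ + 1 := ⟨_, rfl⟩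
  obtain ⟨zaP, hzaP⟩ : ∃ x : ℝ, x = (27 : ℝ) ^ 5 * zW * ab₀ := ⟨_, rfl⟩
  obtain ⟨zsC, hzsC⟩ : ∃ x : ℝ, x = i₂₀ / (2 * zQL) + zaP * zQH ^ 3 / (4 * zQL ^ 2) + zaP * zQH / 4 := ⟨_, rfl⟩
  obtain ⟨zΘ, hzΘ⟩ : ∃ x : ℝ, x = exp 1 * zφ * zt * i₁₀ + exp 1 ^ 2 * zφ * zt ^ 2 * i₂₀ + exp 1 ^ 3 * zφ * zt ^ 3 * (zaP * zQH ^ 3) +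
      exp 1 ^ 3 * zφ * zt ^ 3 * zaP * zQH ^ 3 := ⟨_, rfl⟩
  obtain ⟨uf₀, huf₀⟩ : ∃ x : ℝ, x = min 1 (min (1 / (8 * zs * zQH + 1)) (min (1 / (2 * exp 1 * zt * zQH + 1)) (min (1 / (4 * zφ * zt * i₁₀ + 1))
      (1 / (2 * zΘ + 1))))) := ⟨_, rfl⟩
  obtain ⟨aT₀, haT₀⟩ : ∃ x : ℝ, x = Cinc₀ * (ab₀ + zaP + exp 1 * zφ * zt * (i₁₀ + zsC) ^ 2 / zQL) := ⟨_, rfl⟩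
  obtain ⟨ab, hab⟩ : ∃ x : ℝ, x = Cinc₁ * (ab₀ + zaP + exp 1 * zφ * zt * (i₁₀ + zsC) ^ 2 / zQL) := ⟨_, rfl⟩
  obtain ⟨qT₀, hqT₀⟩ : ∃ x : ℝ, x = Dinc₀ * (1 + Dinc₀ * qb₀ + 4 * zQH + 2 * zt * zp * zQH) / 4 := ⟨_, rfl⟩
  obtain ⟨qb, hqb⟩ : ∃ x : ℝ, x = Dinc₁ * (1 + Dinc₁ * qb₀ + 4 * zQH + 2 * zt * zp * zQH) := ⟨_, rfl⟩
  -- the main tower's r-free closed forms (…NumericsPackageRB) at these amplitudes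
  obtain ⟨pW, hpW⟩ : ∃ x : ℝ, x = 32 * (27 : ℝ) ^ 4 * exp 2 := ⟨_, rfl⟩
  obtain ⟨pZ, hpZ⟩ : ∃ x : ℝ, x = exp 4 * (81 * CJ) ^ 2 / 8 := ⟨_, rfl⟩
  obtain ⟨ps, hps⟩ : ∃ x : ℝ, x = 2 * Cκ * klE0 / (exp 4 * 162 ^ 2 * CJ ^ 2) := ⟨_, rfl⟩
  obtain ⟨pt, hpt⟩ : ∃ x : ℝ, x = exp 2 * (2 * Cκ * klE0) / (162 ^ 2 * CJ ^ 2) := ⟨_, rfl⟩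
  obtain ⟨pp, hpp⟩ : ∃ x : ℝ, x = exp 4 * 162 ^ 2 * CJ ^ 2 / (2 * Cκ * klE0) := ⟨_, rfl⟩
  obtain ⟨pφ, hpφ⟩ : ∃ x : ℝ, x = 9 * Cb * (4 : ℝ) ^ d / ((27 : ℝ) ^ 5 * exp 1 * Cκ * klE0 ^ 2) := ⟨_, rfl⟩
  obtain ⟨pρ, hpρ⟩ : ∃ x : ℝ, x = 2 * exp 6 := ⟨_, rfl⟩
  obtain ⟨pκ, hpκ⟩ : ∃ x : ℝ, x = pW * ((27 : ℝ) ^ 5 * (C₁ / C₂) * (8 : ℝ) ^ (d - 1)) := ⟨_, rfl⟩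
  obtain ⟨QL, hQL⟩ : ∃ x : ℝ, x = pZ * qb := ⟨_, rfl⟩
  obtain ⟨QH, hQH⟩ : ∃ x : ℝ, x = pZ * qb + 1 := ⟨_, rfl⟩
  obtain ⟨yB, hyB⟩ : ∃ x : ℝ, x = i₂ / (2 * QL) + pW * pZ ^ 3 * x₆ / (4 * QL ^ 2) + (pW * (27 : ℝ) ^ 5 + pκ) * ab * QH / 2 := ⟨_, rfl⟩
  obtain ⟨aPB, haPB⟩ : ∃ x : ℝ, x = (pW * (27 : ℝ) ^ 5 + pκ) * ab + 2 * yB / QL := ⟨_, rfl⟩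
  obtain ⟨i₃B, hi₃B⟩ : ∃ x : ℝ, x = pW * pZ ^ 3 * x₆ + aPB * QH ^ 3 := ⟨_, rfl⟩
  obtain ⟨sCB, hsCB⟩ : ∃ x : ℝ, x = i₂ / (2 * QL) + i₃B / (4 * QL ^ 2) + aPB * QH / 4 := ⟨_, rfl⟩
  obtain ⟨Bf, hBf⟩ : ∃ x : ℝ, x = max (max (max 1 (max (8 * pφ * pt * yB) (512 * exp 1 * pp ^ 3 * pt ^ 4 * pφ * pκ * yB / (3 * pρ ^ 3)))) (4 * pφ * pt * sCB))
      (4 * zφ * zt * zsC) := ⟨_, rfl⟩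
  obtain ⟨yP, hyP⟩ : ∃ x : ℝ, x = i₂ / (2 * Bf * QL) + pW * pZ ^ 3 * x₆ / (4 * Bf ^ 2 * QL ^ 2) + (pW * (27 : ℝ) ^ 5 + pκ) * ab * QH / (2 * Bf ^ 2) := ⟨_, rfl⟩
  obtain ⟨yL, hyL⟩ : ∃ x : ℝ, x = (pW * (27 : ℝ) ^ 5 + pκ) * ab * QL / (2 * Bf ^ 2) := ⟨_, rfl⟩
  obtain ⟨aP, haP⟩ : ∃ x : ℝ, x = (pW * (27 : ℝ) ^ 5 + pκ) * ab / Bf ^ 2 + 2 * yP / QL := ⟨_, rfl⟩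
  obtain ⟨aA, haA⟩ : ∃ x : ℝ, x = 2 * yP / (pκ * QL) := ⟨_, rfl⟩
  obtain ⟨aL, haL⟩ : ∃ x : ℝ, x = 3 * yL / (2 * pκ * QH) := ⟨_, rfl⟩
  obtain ⟨i₃c, hi₃c⟩ : ∃ x : ℝ, x = pW * pZ ^ 3 * x₆ / Bf ^ 2 + aP * QH ^ 3 := ⟨_, rfl⟩
  obtain ⟨sC, hsC⟩ : ∃ x : ℝ, x = i₂ / (2 * Bf * QL) + i₃c / (4 * QL ^ 2) + aP * QH / 4 := ⟨_, rfl⟩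
  obtain ⟨Sf, hSf⟩ : ∃ x : ℝ, x = exp 1 * pφ * pt * i₁ + exp 1 ^ 2 * pφ * pt ^ 2 * (i₂ / Bf) + exp 1 ^ 3 * pφ * pt ^ 3 * i₃c + pφ * aP * exp 1 ^ 2 * pt ^ 2 * QH ^ 2 / 2 := ⟨_, rfl⟩
  obtain ⟨R₆, hR₆⟩ : ∃ x : ℝ, x = 1024 * ps * aP * QH / (aL * pρ ^ 3) := ⟨_, rfl⟩
  obtain ⟨R₇, hR₇⟩ : ∃ x : ℝ, x = 64 * exp 1 * pp ^ 3 * pt ^ 4 * pφ * QH ^ 2 * i₁ ^ 2 / (aL * pρ ^ 3 * QL ^ 3) := ⟨_, rfl⟩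
  obtain ⟨ufm, hufm⟩ : ∃ x : ℝ, x = min 1 (min (1 / (8 * ps * QH + 1)) (min (1 / (2 * exp 1 * pt * QH + 1)) (min (1 / (4 * pφ * pt * i₁ + 1))
      (min (1 / (2 * Sf + 1)) (min (1 / (R₆ + 1)) (1 / (R₇ + 1))))))) := ⟨_, rfl⟩
  obtain ⟨qT, hqT⟩ : ∃ x : ℝ, x = Dinc * (1 + C₂' ^ 2 * (2 * qb + pρ * QH) + 4 * QH + 2 * pt * pp * QH) / 4 := ⟨_, rfl⟩
  obtain ⟨aT, haT⟩ : ∃ x : ℝ, x = (27 : ℝ) ^ 5 * (C₁' / C₂') * (ab / Bf ^ 2 + 4 / 3 * (8 : ℝ) ^ (d - 1) * aA) + Cinc * (aP + exp 1 * (i₁ + sC) / (2 * QL)) := ⟨_, rfl⟩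
  obtain ⟨CEfm, hCEfm⟩ : ∃ x : ℝ, x = qT * Bf * max 1 (2 * aT) := ⟨_, rfl⟩
  obtain ⟨uf, huf⟩ : ∃ x : ℝ, x = min ufm uf₀ := ⟨_, rfl⟩
  obtain ⟨CEf₀, hCEf₀⟩ : ∃ x : ℝ, x = qT₀ * Bf * max 1 (2 * aT₀) := ⟨_, rfl⟩
  obtain ⟨CEf, hCEf⟩ : ∃ x : ℝ, x = max CEfm CEf₀ := ⟨_, rfl⟩
  have hBfm : max (max 1 (max (8 * pφ * pt * yB) (512 * exp 1 * pp ^ 3 * pt ^ 4 * pφ * pκ * yB / (3 * pρ ^ 3)))) (4 * pφ * pt * sCB) ≤ Bf := by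
    rw [hBf]; exact le_max_left _ _
  have hBf1 : 1 ≤ Bf := le_trans (le_trans (le_max_left _ _) (le_max_left _ _)) hBfm
  have hBf₀ : 4 * zφ * zt * zsC ≤ Bf := by rw [hBf]; exact le_max_right _ _
  -- the two packages
  obtain ⟨huf₀0, hab0, hqb0, hCEf₀0, hpkgZ⟩ := levNumerics_packageZ hCinc₀ hDinc₀ hCinc₁ hDinc₁ hCκ₀ hCb₀ hCJ₀ hab₀ hqb₀ hi₁₀ hi₂₀
    hzW hzZ hzs hzt hzp hzφ hzQL hzQH hzaP hzsC hzΘ huf₀ haT₀ hab hqT₀ hqb hCEf₀ hBf1 hBf₀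
  obtain ⟨-, hufm0, hCEfm0, hpkg⟩ := levNumerics_packageRB hC₁ hC₂ hC₁' hC₂' hCinc hDinc hCκ hCb hCJ hK1 hd2 hab0 hqb0 hi₁ hi₂ hx₆
    hpW hpZ hps hpt hpp hpφ hpρ hpκ hQL hQH hyB haPB hi₃B hsCB hBfm hyP hyL haP haA haL hi₃c hsC hSf hR₆ hR₇ hufm hqT haT hCEfm
  have huf0 : 0 < uf := by rw [huf]; exact lt_min hufm0 huf₀0
  have hufm_le : uf ≤ ufm := by rw [huf]; exact min_le_left _ _
  have huf₀_le : uf ≤ uf₀ := by rw [huf]; exact min_le_right _ _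
  have hCEfm_le : CEfm ≤ CEf := by rw [hCEf]; exact le_max_left _ _
  have hCEf₀_le : CEf₀ ≤ CEf := by rw [hCEf]; exact le_max_right _ _
  have hCEf0 : 0 ≤ CEf := hCEfm0.trans hCEfm_le
  refine ⟨ab, qb, Bf, uf, CEf, hab0, hqb0, hBf1, huf0, hCEf0, ?_⟩
  intro μ hμ U hU hU9 hU₀' hU₀'' hcU hUuf β hβmin hβc L M _ _ hL3 hM3 n hn1 hnN hreg hhist hfr hosc hd cc n' hreg' hnn' hccuf
    Ab Qb ι₂ X hAbs hQbs hι₂ hι₂s hX hXs Ab' ι₂' X' hAb' hι₂' hX'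
    κb αb crb ccb hκb hαb hcrb hccb W Z σ Φ ψ τ ι₁ hW hZ hσ hΦ hψ hτ hι₁ hι₁s ρk Q' Q κA Yb Y A A' ι₃ hρk hQ' hQ hκA hYb hY hA hA' hι₃
    himp₁ himp₂ hcell Aro Qro Qtot Atot hAro hQro hQtot hAtot Qe hCE hsix
    hZ1 Ab₀ Qb₀ ι₁₀ ι₂₀ hAb₀ hQb₀ hι₁₀0 hι₁₀s hι₂₀0 hι₂₀s ι₁₀' ι₂₀' hι₁₀' hι₂₀' Nb₀ hNb₀0 hcar₀ hlawb₀
    κb₀ αb₀ crb₀ ccb₀ hκb₀ hαb₀ hcrb₀ hccb₀ W₀ Z₀ σ₀ Φ₀ ψ₀ τ₀ hW₀ hZ₀ hσ₀ hΦ₀ hψ₀ hτ₀ A'₀ Q'₀ ι₃₀ hA'₀ hQ'₀ hι₃₀ himp₁₀ himp₂₀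
    jw0 κ0 αw0 ρ0 crw0 ccw0 hκ0 hGB0 hαw0 hrow0 hcol0 hρ0 hθ0 hcrw0 hccw0 hrow0' hcol0' nV0 cF0 cg0 Ag0 Pg0 Auv0 Quv0 hnV0 hcF0 hcg0 hAg0 hPg0 hAuv0 hQuv0 hCEu0
    j hj
  have hβ : 0 < β := KLRegimeSplit.pos_of_klBetaMin_le hβmin
  have hβM : β ≤ M := beta_le_of_klEngM₃_le hM3
  have hM0 : (0 : ℝ) < M := Nat.cast_pos.2 (Nat.pos_of_ne_zero (NeZero.ne M))
  have hKl : 0 ≤ P.Klam := le_trans zero_le_one hK1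
  have hBf0 : 0 < Bf := lt_of_lt_of_le one_pos hBf1
  have hden : 0 < 2 * Bf * P.Klam + 1 := by positivity
  have hden1 : 1 ≤ 2 * Bf * P.Klam + 1 := by
    have h0 : 0 ≤ 2 * Bf * P.Klam := by positivity
    linarith
  have hUuf' : U ≤ ufm := (hUuf.trans (div_le_self huf0.le hden1)).trans hufm_le
  have hAbpos : 0 < Ab := by rw [hAbs]; positivity
  have hQbnn : 0 ≤ Qb := by rw [hQbs]; positivity
  -- the degree caps
  obtain ⟨D, hD3, hDi, hcard⟩ := exists_degreeCap_all L M n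
  have hDall : ∀ k, 1 ≤ k → d * k ≤ n → Fintype.card (SpaceTimeIdx L M × SectorLeg (sectorCount (d * k - 1))) / 2 ≤ D :=
    fun k _ hk => hDi (d * k - 1) (by omega)
  have hD0 : Fintype.card (SpaceTimeIdx L M × SectorLeg (sectorCount 0)) / 2 ≤ D := hDi 0 (Nat.zero_le _)
  -- the main package at these data
  obtain ⟨hBrow, hdoors, hCEpkg⟩ := hpkg β M hβ hβM U hU hUuf' Ab Qb ι₂ X hAbs hQbs hι₂ hι₂s hX hXs Ab' ι₂' X' hAb' hι₂' hX'
    κb αb crb ccb hκb hαb hcrb hccb W Z σ Φ ψ τ ι₁ hW hZ hσ hΦ hψ hτ hι₁ hι₁s ρk Q' Q κA Yb Y A A' ι₃ hρk hQ' hQ hκA hYb hY hA hA' hι₃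
  -- block 0's package at these data
  obtain ⟨⟨hAb₀0, hQb₀0, hA'₀0, hQ'₀0, hZQ₀, hι₁₀'0, hι₂₀'0, hι₃₀0, hΦ₀0, hτ₀0, hW₀0, hZ₀0⟩, hsmallZ, hCEZ, hdomZ, hguardZ⟩ :=
    hpkgZ β M hβ hβM Ab₀ Qb₀ ι₁₀ ι₂₀ hAb₀ hQb₀ hι₁₀0 hι₁₀s hι₂₀0 hι₂₀s ι₁₀' ι₂₀' hι₁₀' hι₂₀' κb₀ αb₀ crb₀ ccb₀ hκb₀ hαb₀ hcrb₀ hccb₀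
      W₀ Z₀ σ₀ Φ₀ ψ₀ τ₀ hW₀ hZ₀ hσ₀ hΦ₀ hψ₀ hτ₀ A'₀ Q'₀ ι₃₀ hA'₀ hQ'₀ hι₃₀
  -- the blocking row
  have hblock := hblk d hd₀d Cκ β M hCκ hCJ.ne' hβ.ne' hM0.ne' κb ccb Z ψ τ hκb hccb hZ hψ hτ
  -- the two doors
  have hlog : 0 < Real.log 4 := Real.log_pos (by norm_num)
  have hUufm : U ≤ ufm / (2 * Bf * P.Klam + 1) := hUuf.trans (div_le_div_of_nonneg_right hufm_le hden.le)
  have hUdoor := hUufm.trans (div_le_div_of_nonneg_right hdoors hden.le)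
  have hccufm : cc ≤ ufm * Real.log 4 / (2 * Bf * P.Klam + 1) :=
    hccuf.trans (div_le_div_of_nonneg_right (mul_le_mul_of_nonneg_right hufm_le hlog.le) hden.le)
  have hcdoor : cc ≤ min 1 (min (1 / (8 * σ * Q' + 1)) (min (1 / (2 * exp 1 * τ * Q' + 1)) (min (1 / (4 * Φ * τ * ι₁ + 1))
        (min (1 / (2 * (Φ * (exp 1 * τ * ι₁ + (exp 1 * τ) ^ 2 * ι₂' + (exp 1 * τ) ^ 3 * ι₃ + A' * (exp 1 * τ * Q') ^ 2 / 2)) + 1))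
          (min (A * Q ^ 3 / (16 * σ * Q' * A' * (4 * Q') ^ 3 + A * Q ^ 3))
            (A * Q ^ 3 / (16 * exp 1 * ψ * (2 * τ * ψ * Q') ^ 2 * Φ * τ ^ 2 * ι₁ ^ 2 + A * Q ^ 3))))))) * Real.log 4 / (2 * Bf * P.Klam + 1) :=
    hccufm.trans (div_le_div_of_nonneg_right (mul_le_mul_of_nonneg_right hdoors hlog.le) hden.le)
  -- the coupling at every level is below `uf`
  have hε0 : ∀ i, 0 ≤ epsCoupling P U i := fun i => by unfold epsCoupling; positivity
  have hlam : ∀ i, i ≤ n → Bf * epsCoupling P U i ≤ uf := by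
    intro i hi
    have hin' : (i : ℝ) ≤ n' := Nat.cast_le.2 (hi.trans hnn')
    have hreg'' : U ^ 2 * (n' : ℝ) * Real.log 4 ≤ cc := by
      have h := hreg'
      simp only [IsKLRegime, Int.cast_neg, Int.cast_natCast, abs_neg, Nat.abs_cast] at h
      exact h
    have h1 : U ^ 2 * (i : ℝ) ≤ uf / (2 * Bf * P.Klam + 1) := by
      have h2 : U ^ 2 * (n' : ℝ) ≤ cc / Real.log 4 := by rw [le_div_iff₀ hlog]; exact hreg''
      have h3 : cc / Real.log 4 ≤ uf / (2 * Bf * P.Klam + 1) := by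
        rw [div_le_iff₀ hlog]
        calc cc ≤ uf * Real.log 4 / (2 * Bf * P.Klam + 1) := hccuf
          _ = uf / (2 * Bf * P.Klam + 1) * Real.log 4 := by ring
      calc U ^ 2 * (i : ℝ) ≤ U ^ 2 * (n' : ℝ) := by gcongr
        _ ≤ uf / (2 * Bf * P.Klam + 1) := h2.trans h3
    unfold epsCoupling
    rw [abs_of_pos hU]
    calc Bf * (P.Klam * (U + U ^ 2 * (i : ℝ))) ≤ Bf * (P.Klam * (uf / (2 * Bf * P.Klam + 1) + uf / (2 * Bf * P.Klam + 1))) := by gcongr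
      _ = uf * (2 * Bf * P.Klam / (2 * Bf * P.Klam + 1)) := by field_simp; ring
      _ ≤ uf * 1 := by
          refine mul_le_mul_of_nonneg_left ?_ huf0.le
          rw [div_le_one hden]; linarith
      _ = uf := mul_one _
  have hlamm : ∀ i, i ≤ n → Bf * epsCoupling P U i ≤ ufm := fun i hi => (hlam i hi).trans hufm_le
  have hlam₀ : ∀ i, i ≤ n → Bf * epsCoupling P U i ≤ uf₀ := fun i hi => (hlam i hi).trans huf₀_le
  have hl0 : ∀ i, 0 ≤ Bf * epsCoupling P U i := fun i => mul_nonneg hBf0.le (hε0 i)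
  -- the main tower's CE rows
  have hCEmain : ∀ i : ℕ, d ≤ i → i ≤ n → Qtot * imagTimeWeight β M ^ 2 * Bf * max 1 (Atot i / imagTimeWeight β M) ≤ Qe.CE :=
    fun i _ hi => ((hCEpkg (Bf * epsCoupling P U i) (hl0 i) (hlamm i hi) Aro Qro Qtot (Atot i) hAro hQro hQtot (hAtot i)).trans hCEfm_le).trans hCE
  -- BLOCK 0: the Chernoff rows of `μ̄ m = W₀·Z₀^m·klTowerMuLevF … 1 1 m` at `λ_1` from the level-0 datum rows and the pinned profile
  have hε1 : 0 < epsCoupling P U 1 := by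
    unfold epsCoupling
    have : 0 < |U| + U ^ 2 * ((1 : ℕ) : ℝ) := by positivity
    positivity
  have hl1 : 0 < Bf * epsCoupling P U 1 := mul_pos hBf0 hε1
  have hμF : ∀ m, 3 ≤ m → klTowerMuLevF L M β U μ (klFlowFrameU L M β U μ n) 1 1 m ≤
      (27 : ℝ) ^ 5 * Ab₀ * (Bf * epsCoupling P U 1) ^ (m - 1) * Qb₀ ^ m :=
    fun m hm => klTowerMuLevF_one_le_of_baseRows (L := L) (M := M) hβ U μ (klFlowFrameU L M β U μ n) 1 hl1.le hAb₀0 hQb₀0 Nb₀ hNb₀0 hcar₀ hlawb₀ hm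
  have hrow : ∀ m, 3 ≤ m → W₀ * Z₀ ^ m * klTowerMuLevF L M β U μ (klFlowFrameU L M β U μ n) 1 1 m ≤ A'₀ * (Bf * epsCoupling P U 1) ^ (m - 1) * Q'₀ ^ m := by
    intro m hm
    have hZQb : 0 ≤ Z₀ * Qb₀ := mul_nonneg hZ₀0.le hQb₀0
    calc W₀ * Z₀ ^ m * klTowerMuLevF L M β U μ (klFlowFrameU L M β U μ n) 1 1 m
        ≤ W₀ * Z₀ ^ m * ((27 : ℝ) ^ 5 * Ab₀ * (Bf * epsCoupling P U 1) ^ (m - 1) * Qb₀ ^ m) := mul_le_mul_of_nonneg_left (hμF m hm) (by positivity)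
      _ = (27 : ℝ) ^ 5 * W₀ * Ab₀ * (Bf * epsCoupling P U 1) ^ (m - 1) * (Z₀ * Qb₀) ^ m := by rw [mul_pow]; ring
      _ ≤ A'₀ * (Bf * epsCoupling P U 1) ^ (m - 1) * Q'₀ ^ m := by
          rw [hA'₀]; exact mul_le_mul_of_nonneg_left (pow_le_pow_left₀ hZQb hZQ₀ m) (by rw [← hA'₀]; exact mul_nonneg hA'₀0 (pow_nonneg hl1.le _))
  have hprof₀ : ∀ m, 4 ≤ m → m ≤ D → W₀ * Z₀ ^ m * klTowerMuLevF L M β U μ (klFlowFrameU L M β U μ n) 1 1 m ≤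
      A'₀ * (Bf * epsCoupling P U 1) ^ (m - 1) * Q'₀ ^ m := fun m hm _ => hrow m (by omega)
  have hprof3₀ : W₀ * Z₀ ^ 3 * klTowerMuLevF L M β U μ (klFlowFrameU L M β U μ n) 1 1 3 ≤ ι₃₀ * (Bf * epsCoupling P U 1) ^ 2 := by
    rw [hι₃₀]
    calc W₀ * Z₀ ^ 3 * klTowerMuLevF L M β U μ (klFlowFrameU L M β U μ n) 1 1 3 ≤ A'₀ * (Bf * epsCoupling P U 1) ^ (3 - 1) * Q'₀ ^ 3 := hrow 3 le_rfl
      _ = A'₀ * Q'₀ ^ 3 * (Bf * epsCoupling P U 1) ^ 2 := by norm_num; ring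
  -- block 0's numerics rows, discharged
  have hsmall₀ : ∀ j : ℕ, 1 ≤ j → j ≤ d → j ≤ n →
      4 * σ₀ * (Bf * epsCoupling P U j) * Q'₀ < 1 ∧ 2 * (Bf * epsCoupling P U j) * τ₀ * Q'₀ ≤ 1 ∧ exp 1 * τ₀ * (Bf * epsCoupling P U j) * Q'₀ < 1 ∧
      Φ₀ * (τ₀ * (ι₁₀' * (Bf * epsCoupling P U j) + ι₂₀' / (2 * Q'₀) + ι₃₀ / (4 * Q'₀ ^ 2) + A'₀ * Q'₀ / 4)) < 1 ∧
      Φ₀ * (exp 1 * τ₀ * (ι₁₀' * (Bf * epsCoupling P U j)) + (exp 1 * τ₀) ^ 2 * (ι₂₀' * (Bf * epsCoupling P U j)) +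
          (exp 1 * τ₀) ^ 3 * (ι₃₀ * (Bf * epsCoupling P U j) ^ 2) +
        A'₀ * (exp 1 * τ₀ * Q'₀) * ((exp 1 * τ₀ * (Bf * epsCoupling P U j) * Q'₀) ^ 3 / (1 - exp 1 * τ₀ * (Bf * epsCoupling P U j) * Q'₀))) < 1 :=
    fun j _ _ hjn => hsmallZ (Bf * epsCoupling P U j) (hl0 j) (hlam₀ j hjn)
  obtain ⟨Qtot₀, hQtot₀⟩ : ∃ x : ℝ, x = Dinc₀ * max 1 (max (Dinc₀ * Qb₀) (max (4 * Q'₀) (2 * τ₀ * ψ₀ * Q'₀))) := ⟨_, rfl⟩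
  obtain ⟨Atot₀, hAtot₀⟩ : ∃ f : ℕ → ℝ, ∀ j : ℕ, f j = Cinc₀ * Ab₀ + Cinc₀ * (A'₀ * (4 * σ₀ * (Bf * epsCoupling P U j) * Q'₀ / (1 - 4 * σ₀ * (Bf * epsCoupling P U j) * Q'₀)) +
      exp 1 * (τ₀ * (ι₁₀' * (Bf * epsCoupling P U j) + ι₂₀' / (2 * Q'₀) + ι₃₀ / (4 * Q'₀ ^ 2) + A'₀ * Q'₀ / 4)) *
        (Φ₀ * (τ₀ * (ι₁₀' * (Bf * epsCoupling P U j) + ι₂₀' / (2 * Q'₀) + ι₃₀ / (4 * Q'₀ ^ 2) + A'₀ * Q'₀ / 4)) /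
          (1 - Φ₀ * (τ₀ * (ι₁₀' * (Bf * epsCoupling P U j) + ι₂₀' / (2 * Q'₀) + ι₃₀ / (4 * Q'₀ ^ 2) + A'₀ * Q'₀ / 4)))) / (2 * τ₀ * Q'₀)) :=
    ⟨_, fun _ => rfl⟩
  have hCE₀ : ∀ j : ℕ, 1 ≤ j → j < d → j ≤ n → Qtot₀ * imagTimeWeight β M ^ 2 * Bf * max 1 (Atot₀ j / imagTimeWeight β M) ≤ Qe.CE :=
    fun j _ _ hjn => ((hCEZ (Bf * epsCoupling P U j) (hl0 j) (hlam₀ j hjn) (Cinc₀ * Ab₀) (Dinc₀ * Qb₀) Qtot₀ (Atot₀ j) rfl rfl hQtot₀ (hAtot₀ j)).trans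
      hCEf₀_le).trans hCE
  obtain ⟨Qtot₁, hQtot₁⟩ : ∃ x : ℝ, x = Dinc₁ * max 1 (max (Dinc₁ * Qb₀) (max (4 * Q'₀) (2 * τ₀ * ψ₀ * Q'₀))) := ⟨_, rfl⟩
  obtain ⟨Atot₁, hAtot₁⟩ : ∃ x : ℝ, x = Cinc₁ * Ab₀ + Cinc₁ * (A'₀ * (4 * σ₀ * (Bf * epsCoupling P U d) * Q'₀ / (1 - 4 * σ₀ * (Bf * epsCoupling P U d) * Q'₀)) +
      exp 1 * (τ₀ * (ι₁₀' * (Bf * epsCoupling P U d) + ι₂₀' / (2 * Q'₀) + ι₃₀ / (4 * Q'₀ ^ 2) + A'₀ * Q'₀ / 4)) *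
        (Φ₀ * (τ₀ * (ι₁₀' * (Bf * epsCoupling P U d) + ι₂₀' / (2 * Q'₀) + ι₃₀ / (4 * Q'₀ ^ 2) + A'₀ * Q'₀ / 4)) /
          (1 - Φ₀ * (τ₀ * (ι₁₀' * (Bf * epsCoupling P U d) + ι₂₀' / (2 * Q'₀) + ι₃₀ / (4 * Q'₀ ^ 2) + A'₀ * Q'₀ / 4)))) / (2 * τ₀ * Q'₀)) :=
    ⟨_, rfl⟩
  have hdom : d ≤ n → Atot₁ ≤ Ab' ∧ Qtot₁ ≤ Qb := by
    intro hdn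
    obtain ⟨h1, h2⟩ := hdomZ (Bf * epsCoupling P U d) (hl0 d) (hlam₀ d hdn) (Cinc₁ * Ab₀) (Dinc₁ * Qb₀) Qtot₁ Atot₁ rfl rfl hQtot₁ hAtot₁
    refine ⟨?_, ?_⟩
    · rw [hAb', hAbs]; exact h1
    · rw [hQbs]; exact h2
  have hguard₀ : Φ₀ * towerV D τ₀ (fun m => W₀ * Z₀ ^ m * klTowerMuLevF L M β U μ (klFlowFrameU L M β U μ n) 1 1 m) < 1 :=
    hguardZ (Bf * epsCoupling P U 1) (hl0 1) (hlam₀ 1 hn1) D (fun m => W₀ * Z₀ ^ m * klTowerMuLevF L M β U μ (klFlowFrameU L M β U μ n) 1 1 m)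
      (fun m => mul_nonneg (by positivity) (klTowerMuLevF_nonneg (L := L) (M := M) hβ U μ _ 1 1 m)) himp₁₀ himp₂₀ hprof3₀ hprof₀
  -- the assembly of record (closed, guarded)
  exact h' G P Qh c hP hc hc6 hc₃' hc₃'' μ hμ U hU hU9 hU₀' hU₀'' hcU β hβmin hβc L M hL3 hM3 n hn1 hnN hreg hhist hfr hosc hd D hD3 cc n' hreg' hnn' Bf hBf1
    Ab Qb ι₂ X hAbpos hQbnn hι₂ hX Ab' ι₂' X' hAb' hι₂' hX'
    κb αb crb ccb hκb hαb hcrb hccb hDall W Z σ Φ ψ τ ι₁ hW hZ hσ hΦ hψ hτ hι₁ ρk Q' Q κA Yb Y A A' ι₃ hρk hQ' hQ hκA hYb hY hA hA' hι₃ hblock hBrow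
    himp₁ himp₂ hcell hUdoor hcdoor Aro Qro Qtot Atot hAro hQro hQtot hAtot Qe hCEmain hcard hsix
    hZ1 Ab₀ Qb₀ hAb₀0 hQb₀0 Nb₀ hNb₀0 hcar₀ hlawb₀ hD0 κb₀ αb₀ crb₀ ccb₀ hκb₀ hαb₀ hcrb₀ hccb₀ W₀ Z₀ σ₀ Φ₀ ψ₀ τ₀ hW₀ hZ₀ hσ₀ hΦ₀ hψ₀ hτ₀
    A'₀ Q'₀ ι₁₀' ι₂₀' ι₃₀ hA'₀0 hQ'₀0 hprof₀ hprof3₀ himp₁₀ himp₂₀ hsmall₀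
    (Cinc₀ * Ab₀) (Dinc₀ * Qb₀) Qtot₀ Atot₀ rfl rfl hQtot₀ hAtot₀ hCE₀
    (Cinc₁ * Ab₀) (Dinc₁ * Qb₀) Qtot₁ Atot₁ rfl rfl hQtot₁ hAtot₁ (fun hdn => (hdom hdn).1) (fun hdn => (hdom hdn).2) hguard₀
    jw0 κ0 αw0 ρ0 crw0 ccw0 hκ0 hGB0 hαw0 hrow0 hcol0 hρ0 hθ0 hcrw0 hccw0 hrow0' hcol0' nV0 cF0 cg0 Ag0 Pg0 Auv0 Quv0 hnV0 hcF0 hcg0 hAg0 hPg0 hAuv0 hQuv0 hCEu0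
    j hj

end Summit.HubbardSuperconductivity.HubbardSuperconductivity.Theorems.EngineV8

end
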